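import Summits.FinalStateConjecture.FinalStateConjecture.Theorems.ClusterCompletenessOmegaLimitMultiKerrSequential
import Summits.FinalStateConjecture.FinalStateConjecture.Theorems.ClusterCompletenessOmegaLimitMultiKerrStarHoleDictionary
import Summits.FinalStateConjecture.FinalStateConjecture.Theorems.ClusterCompletenessOmegaLimitMultiKerrJointOmegaLimits
import HarnessLib

/-!
# Route ClusterCompleteness · crux `OmegaLimitMultiKerr` — the recur-disjunct FROM star era charts:
# flat-chart recurrence plus flat hole ω-limits along one sequence of times give `Recurs k 𝒟`

Structure lemma for the crux stmt-FinalStateConjecture-14664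
(`ClusterCompleteness.OmegaLimitMultiKerr`), line `Sketch`, lead gen 4, stub `RecursOfStarEra`
(registered main theorem `recurs_of_starCharts_of_omegaLimits_flat`, closed form).

The recommended re-line of the crux splits "generically, some MGHD settles or RECURS" into a
GENERIC stub ("tame era charts": anchored, separating, exhaustive final-state-shaped late charts
whose hole charts are defined across the horizons, on the star backgrounds
`starBackground Λᵢ cᵢ Mᵢ aᵢ rfᵢ` of `NearKerrLeaf`, domain `{r(Λᵢ⁻¹(x − cᵢ)) > max Mᵢ 0}`) and a
POINTWISE chain "tame era charts whose ω-limits are flat (= Kerr in chart coordinates) ⇒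
`Recurs k 𝒟`". This file is the pointwise GLUE of that LaSalle reading, in crux currency and
definition-free:

* `recurs_of_starCharts_of_omegaLimits_flat` (MAIN, registered) — take the data of `Recurs k 𝒟`
  (`ClusterCompletenessOmegaLimitMultiKerrDefs`, clauses 1–10 VERBATIM: sub-extremal labels, late
  hole charts and a late flat chart into `O`, sublinear tubes, radii `Rᵢ → ∞`, tube complement
  inside `U₀`, separation at every radius, `O = exteriorOf (charted)`, exhaustion at every chart
  time, the uniform `C⁰` anchor) but with every hole chart given as the RESTRICTION `Ψsᵢ ∘ ι` of a
  smooth chart `Ψsᵢ` on the star background to the exterior background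
  `boostedKerrBackground Λᵢ cᵢ Mᵢ aᵢ` (along `boostedKerrExterior_le_starBackground_domain`), plus
  ONE sequence of chart times `T n → ∞` along which (α) the flat chart recurs in `Cᵏ`
  (`deviationCk (Minkowski.backgroundOn U₀) Ψ₀ k (T n) → 0`, kept as a hypothesis: the flat slabs
  are not compact) and (β) every hole's star deviation `dev★ᵢ = Ψsᵢ^* g − g_{Mᵢ,aᵢ,Λᵢ,cᵢ}` has a
  `Cᵏ_loc` ω-limit `gᵢ` on the star domain, FLAT to order `k` on the time-zero exterior slab
  `{t*ᵢ = 0} ∩ {r > max r₊ 0}`; conclude `Recurs k 𝒟`. Proof: the sequential form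
  `recurs_iff_exists_seq` (`…Sequential`, lead gen 3) and, hole by hole and radius by radius, the
  backward direction of the dictionary
  `tendsto_truncDeviationCk_restrict_star_iff_iteratedFDeriv_omegaLimit_eq_zero`
  (`…StarHoleDictionary`, wave 2 of this cycle);
* `exists_holes_of_recurs_forall_starExtension_omegaLimit_flat` — the converse packaging at crux
  level, per hole: if `𝒟` recurs at order `k`, its hole charts `Ψᵢ` and one recurrence sequence
  `T n → ∞` are such that WHENEVER `Ψᵢ` extends to a smooth star chart `Ψs` (radius parameter the
  rest-frame Kerr–Schild radius) which is TAME after `τ₀` (finite `C^{k+1}` sup norms of `dev★` on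
  the star truncated late regions), then along a subsequence of `T` the star deviation has a
  `Cᵏ_loc` ω-limit on the star domain flat to order `k` on the CLOSED slab `{t* = 0, r ≥ r₊}`
  (`starHole_omegaLimit_flat_of_recurrence`);
* `exists_holes_of_recurs_strictMono_forall_starExtension_omegaLimit_flat` — the same JOINTLY: if
  ALL hole charts extend to tame smooth star charts, ONE common subsequence of `T` gives every hole
  such a flat ω-limit on its star domain (the joint extraction
  `exists_strictMono_forall_omegaLimit_translate` of `…JointOmegaLimits`, lead gen 3, for the star
  systems, then the dictionary hole by hole) — the joint ω-limits the identification step consumes.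

What remains for a line of the crux is therefore (i) the generic existence of tame, anchored,
separating, exhaustive era charts with margin and (ii) the IDENTIFICATION of the ω-limits. LaSalle's
invariance principle (the orbit recurs to the reference configuration along `T` iff the latter is
its ω-limit along `T`): Hale 1980, Ch. I, §8. Everything is proved; Mathlib + landed `Theorems`
files only, no definitions.
-/

-- every `Summit.FinalStateConjecture.FinalStateConjecture.…` name repeats the summit = sub-problem segment (D-0017 layout)
set_option linter.dupNamespace false

noncomputable section

open scoped Manifold ContDiff Topology ENNReal
open Set Filter TopologicalSpace

namespace Summit.FinalStateConjecture.FinalStateConjecture.Theorems.ClusterCompleteness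

open Literature.Geometry.Lorentzian

/-! ### Star era charts with flat ω-limits along one sequence of times recur -/

/-- **Registered structure stub (crux stmt-FinalStateConjecture-14664, line `Sketch`, stub
`RecursOfStarEra`): the pointwise glue of the LaSalle re-line.** Let `𝒟` be a vacuum maximal
development carrying the data of `Recurs k 𝒟` — a region `O`, `N` sub-extremal labels `(Mᵢ, aᵢ)`
with motions `(Λᵢ, cᵢ)`, a late time `τ₀`, hole charts which are late charts for the exterior
backgrounds `boostedKerrBackground Λᵢ cᵢ Mᵢ aᵢ`, a late flat chart `Ψ₀` on `U₀`, sublinear tubes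
`ρᵢ`, exhaustion radii `Rᵢ → ∞`, the tube complement inside `U₀`, separation of the holes at every
radius, `O = exteriorOf (charted)`, exhaustion of `O` at every chart time `τ₁ > τ₀` and the uniform
`C⁰` anchor (clauses 1–10 of `Recurs` verbatim) — in which every hole chart is the RESTRICTION
`Ψsᵢ ∘ ι` to the exterior of a SMOOTH chart `Ψsᵢ` defined on the horizon-penetrating star
background `starBackground Λᵢ cᵢ Mᵢ aᵢ rfᵢ` (era charts "with margin"). If along ONE sequence of
chart times `T n → ∞` (α) the flat chart recurs in `Cᵏ`, `deviationCk (Minkowski.backgroundOn U₀)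
Ψ₀ k (T n) → 0`, and (β) for every hole the translates `dev★ᵢ (· + T n • Λᵢ∂₀)` of the star
deviation `dev★ᵢ = Ψsᵢ^* g − g_{Mᵢ,aᵢ,Λᵢ,cᵢ}` converge in `Cᵏ` on every compact subset of the star
domain to a `Cᵏ` field `gᵢ` all of whose derivatives of order `≤ k` vanish on the time-zero
exterior slab `{t*ᵢ = 0} ∩ {r > max r₊ 0}`, THEN `𝒟` recurs at order `k`. Indeed by the backward
direction of the dictionary
`tendsto_truncDeviationCk_restrict_star_iff_iteratedFDeriv_omegaLimit_eq_zero`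
(`…StarHoleDictionary`, wave 2) every restricted hole chart recurs at every exterior radius along
`T`, which with (α) is the sequential form `recurs_iff_exists_seq` (`…Sequential`, c3) of the
recurrence clause. For era charts with margin the recur-disjunct of the crux thus FOLLOWS from
flat-chart recurrence plus flatness of the hole ω-limits along one sequence of times — what remains
for a line is (i) the generic existence of tame anchored separating exhaustive era charts and
(ii) the IDENTIFICATION of the ω-limits (LaSalle: Hale 1980, Ch. I, §8). Closed form.
[cite: Hale1980, Ch. I §8] -/
theorem recurs_of_starCharts_of_omegaLimits_flat :
    ∀ {X : Type} [TopologicalSpace X] [ChartedSpace E3 X] [IsManifold (𝓡 3) ∞ X]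
      [ConnectedSpace X] {D : InitialDataSet (𝓡 3) X} (k : ℕ) (𝒟 : VacuumCauchyDevelopment D)
      (O : Set 𝒟.carrier) (N : ℕ) (M a : Fin N → ℝ) (mo : Fin N → lorentzGroup × E4) (τ₀ : ℝ)
      (rf : Fin N → E4 → ℝ)
      (Ψs : ∀ i, (starBackground (mo i).1 (mo i).2 (M i) (a i) (rf i)).domain → 𝒟.carrier)
      (ρ R : Fin N → ℝ → ℝ) (U₀ : Opens E4) (Ψ₀ : U₀ → 𝒟.carrier),
      (∀ i, Kerr.IsSubextremal (M i) (a i)) →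
      (∀ i, ContMDiff 𝓘(ℝ, E4) (𝓡 4) ∞ (Ψs i)) →
      (∀ i, 𝒟.toSpacetime.IsLateChart (boostedKerrBackground (mo i).1 (mo i).2 (M i) (a i)) O τ₀
        (Ψs i ∘ Opens.inclusion
          (boostedKerrExterior_le_starBackground_domain (mo i).1 (mo i).2 (M i) (a i) (rf i)))) →
      𝒟.toSpacetime.IsLateChart (Minkowski.backgroundOn U₀) O τ₀ Ψ₀ →
      (∀ i, Tendsto (fun t ↦ ρ i t / t) atTop (𝓝 0)) → (∀ i, Tendsto (R i) atTop atTop) →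
      {x : E4 | τ₀ < x 0 ∧ ∀ i, ρ i (x 0) <
        Kerr.radius (a i) (poincareInv (mo i).1 (mo i).2 x)} ⊆ (U₀ : Set E4) →
      (∀ R' : ℝ, ∃ τ₁ : ℝ, Pairwise (Function.onFun Disjoint fun i ↦ (Ψs i ∘ Opens.inclusion
          (boostedKerrExterior_le_starBackground_domain (mo i).1 (mo i).2 (M i) (a i) (rf i))) ''
        (boostedKerrBackground (mo i).1 (mo i).2 (M i) (a i)).truncLateRegion τ₁ R')) →
      O = Summit.FinalStateConjecture.exteriorOf 𝒟.toCauchyDevelopment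
        ((⋃ i, (Ψs i ∘ Opens.inclusion
            (boostedKerrExterior_le_starBackground_domain (mo i).1 (mo i).2 (M i) (a i) (rf i))) ''
          (boostedKerrBackground (mo i).1 (mo i).2 (M i) (a i)).lateRegion τ₀) ∪
          Ψ₀ '' (Minkowski.backgroundOn U₀).lateRegion τ₀) →
      (∀ τ₁ : ℝ, τ₀ < τ₁ → O \ (Ψ₀ '' (Minkowski.backgroundOn U₀).lateRegion τ₁ ∪
        ⋃ i, (Ψs i ∘ Opens.inclusion
            (boostedKerrExterior_le_starBackground_domain (mo i).1 (mo i).2 (M i) (a i) (rf i))) ''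
          {x | τ₁ < (boostedKerrBackground (mo i).1 (mo i).2 (M i) (a i)).time x.1 ∧
            (boostedKerrBackground (mo i).1 (mo i).2 (M i) (a i)).radius x.1 ≤
              R i ((boostedKerrBackground (mo i).1 (mo i).2 (M i) (a i)).time x.1)}) ⊆
        𝒟.metric.causalPast 𝒟.timeOrientation (Ψ₀ '' (Minkowski.backgroundOn U₀).timeSlab τ₁ ∪
          ⋃ i, (Ψs i ∘ Opens.inclusion
            (boostedKerrExterior_le_starBackground_domain (mo i).1 (mo i).2 (M i) (a i) (rf i))) ''
            (boostedKerrBackground (mo i).1 (mo i).2 (M i) (a i)).truncTimeSlab (R i τ₁) τ₁)) →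
      (∀ τ : ℝ, τ₀ < τ →
        𝒟.toSpacetime.deviationCk (Minkowski.backgroundOn U₀) Ψ₀ 0 τ ≤ ENNReal.ofReal (1 / 4) ∧
        ∀ i, 𝒟.toSpacetime.truncDeviationCk (boostedKerrBackground (mo i).1 (mo i).2 (M i) (a i))
          (Ψs i ∘ Opens.inclusion
            (boostedKerrExterior_le_starBackground_domain (mo i).1 (mo i).2 (M i) (a i) (rf i)))
          0 (R i τ) τ ≤ ENNReal.ofReal (1 / 4)) →
      (∃ T : ℕ → ℝ, Tendsto T atTop atTop ∧
        Tendsto (fun n ↦ 𝒟.toSpacetime.deviationCk (Minkowski.backgroundOn U₀) Ψ₀ k (T n)) atTop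
          (𝓝 0) ∧
        ∀ i, ∃ g : E4 → E4 →L[ℝ] E4 →L[ℝ] ℝ,
          ContDiffOn ℝ k g
            ((starBackground (mo i).1 (mo i).2 (M i) (a i) (rf i)).domain : Set E4) ∧
          (∀ K ⊆ ((starBackground (mo i).1 (mo i).2 (M i) (a i) (rf i)).domain : Set E4),
            IsCompact K →
            Tendsto (fun n ↦ supCkENorm K k (fun x ↦
              𝒟.toSpacetime.deviationExtend (starBackground (mo i).1 (mo i).2 (M i) (a i) (rf i))
                (Ψs i) (x + T n • ((mo i).1 : E4 ≃L[ℝ] E4)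
                  (EuclideanSpace.single (0 : Fin 4) (1 : ℝ))) - g x)) atTop (𝓝 0)) ∧
          ∀ x ∈ Subtype.val '' (boostedKerrBackground (mo i).1 (mo i).2 (M i) (a i)).timeSlab 0,
            ∀ m, m ≤ k → iteratedFDeriv ℝ m g x = 0) →
      Recurs k 𝒟 := by
  intro X _ _ _ _ D k 𝒟 O N M a mo τ₀ rf Ψs ρ R U₀ Ψ₀ hsub hsmooth hlate hflat hρ hR hU₀ hsep hO
    hexh hanchor hT
  obtain ⟨T, hT, hflatT, hholes⟩ := hT
  -- the sequential form of `Recurs k 𝒟` with the restricted hole charts; clauses 1–10 are data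
  refine (recurs_iff_exists_seq k 𝒟).2 ⟨O, N, M, a, mo, τ₀, fun i ↦ Ψs i ∘ Opens.inclusion
    (boostedKerrExterior_le_starBackground_domain (mo i).1 (mo i).2 (M i) (a i) (rf i)), ρ, R, U₀,
    Ψ₀, hsub, hlate, hflat, hρ, hR, hU₀, hsep, hO, hexh, hanchor, T, hT, hflatT, fun i R' ↦ ?_⟩
  -- hole `i`, radius `R'`: the backward direction of the dictionary for star charts
  obtain ⟨g, hg, hlim, hzero⟩ := hholes i
  exact (tendsto_truncDeviationCk_restrict_star_iff_iteratedFDeriv_omegaLimit_eq_zero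
    𝒟.toSpacetime (mo i).1 (mo i).2 (hsub i) (rf i) (hsmooth i) hg hlim).2 hzero R'

/-! ### Conversely: the hole charts of `Recurs k 𝒟` feed the star dictionary -/

/-- **`Recurs k 𝒟` feeds the star dictionary, hole by hole.** If the maximal development `𝒟`
recurs at order `k`, then there are hole data — sub-extremal labels `(Mᵢ, aᵢ)`, motions
`moᵢ = (Λᵢ, cᵢ)`, a late time `τ₀`, smooth hole charts `Ψᵢ` on the exterior backgrounds
`boostedKerrBackground Λᵢ cᵢ Mᵢ aᵢ` — and ONE sequence of chart times `T n → ∞` along which every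
hole recurs at every radius (`truncDeviationCk … (Ψ i) k R' (T n) → 0`, the sequential form
`recurs_iff_exists_seq`), such that for every hole `i`: WHENEVER `Ψᵢ` EXTENDS to a smooth chart
`Ψs` on the horizon-penetrating star background
`starBackground Λᵢ cᵢ Mᵢ aᵢ (x ↦ r_{aᵢ}(Λᵢ⁻¹(x − cᵢ)))` (`Ψ i = Ψs ∘ ι`, definition-free "era chart
with margin") which is TAME after `τ₀` (finite
`C^{k+1}` sup norm of the star deviation `dev★ = Ψs^* g − g_{Mᵢ,aᵢ,Λᵢ,cᵢ}` over every star
truncated late region `{t* > τ₀, r ≤ R}`), there are a `Cᵏ` field `g` on the star domain and a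
subsequence `φ` along which the translates `dev★ (· + T (φ n) • Λᵢ∂₀)` converge to `g` in `Cᵏ` on
every compact subset of the STAR domain, and `g` is flat to order `k` on the CLOSED time-zero slab
`{t* = 0, r ≥ r₊}`, horizon included — per hole exactly `starHole_omegaLimit_flat_of_recurrence`
(`…StarHoleDictionary`). The necessity half of the LaSalle reading of the recur-disjunct for era
charts with margin (Hale 1980, Ch. I, §8; a COMMON subsequence for all holes is the joint
extraction of `…JointOmegaLimits`, not restated here). [cite: Hale1980, Ch. I §8] -/
theorem exists_holes_of_recurs_forall_starExtension_omegaLimit_flat :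
    ∀ {X : Type} [TopologicalSpace X] [ChartedSpace E3 X] [IsManifold (𝓡 3) ∞ X]
      [ConnectedSpace X] {D : InitialDataSet (𝓡 3) X} (k : ℕ) (𝒟 : VacuumCauchyDevelopment D),
      Recurs k 𝒟 →
      ∃ (N : ℕ) (M a : Fin N → ℝ) (mo : Fin N → lorentzGroup × E4) (τ₀ : ℝ)
        (Ψ : ∀ i, (boostedKerrBackground (mo i).1 (mo i).2 (M i) (a i)).domain → 𝒟.carrier)
        (T : ℕ → ℝ),
        (∀ i, Kerr.IsSubextremal (M i) (a i)) ∧ (∀ i, ContMDiff 𝓘(ℝ, E4) (𝓡 4) ∞ (Ψ i)) ∧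
        Tendsto T atTop atTop ∧
        (∀ i (R' : ℝ), Tendsto (fun n ↦ 𝒟.toSpacetime.truncDeviationCk
          (boostedKerrBackground (mo i).1 (mo i).2 (M i) (a i)) (Ψ i) k R' (T n)) atTop (𝓝 0)) ∧
        ∀ i (Ψs : (starBackground (mo i).1 (mo i).2 (M i) (a i)
            fun x ↦ Kerr.radius (a i) (poincareInv (mo i).1 (mo i).2 x)).domain → 𝒟.carrier),
          ContMDiff 𝓘(ℝ, E4) (𝓡 4) ∞ Ψs →
          Ψ i = Ψs ∘ Opens.inclusion (boostedKerrExterior_le_starBackground_domain (mo i).1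
            (mo i).2 (M i) (a i) fun x ↦ Kerr.radius (a i) (poincareInv (mo i).1 (mo i).2 x)) →
          (∀ R : ℝ, supCkENorm (Subtype.val '' (starBackground (mo i).1 (mo i).2 (M i) (a i)
              fun x ↦ Kerr.radius (a i) (poincareInv (mo i).1 (mo i).2 x)).truncLateRegion τ₀ R)
            (k + 1) (𝒟.toSpacetime.deviationExtend (starBackground (mo i).1 (mo i).2 (M i) (a i)
              fun x ↦ Kerr.radius (a i) (poincareInv (mo i).1 (mo i).2 x)) Ψs) ≠ ⊤) →
          ∃ (g : E4 → E4 →L[ℝ] E4 →L[ℝ] ℝ) (φ : ℕ → ℕ), StrictMono φ ∧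
            ContDiffOn ℝ k g ((starBackground (mo i).1 (mo i).2 (M i) (a i)
              fun x ↦ Kerr.radius (a i) (poincareInv (mo i).1 (mo i).2 x)).domain : Set E4) ∧
            (∀ K ⊆ ((starBackground (mo i).1 (mo i).2 (M i) (a i)
                fun x ↦ Kerr.radius (a i) (poincareInv (mo i).1 (mo i).2 x)).domain : Set E4),
              IsCompact K →
              Tendsto (fun n ↦ supCkENorm K k (fun x ↦
                𝒟.toSpacetime.deviationExtend (starBackground (mo i).1 (mo i).2 (M i) (a i)
                  fun x ↦ Kerr.radius (a i) (poincareInv (mo i).1 (mo i).2 x)) Ψs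
                  (x + T (φ n) • ((mo i).1 : E4 ≃L[ℝ] E4)
                    (EuclideanSpace.single (0 : Fin 4) (1 : ℝ))) - g x)) atTop (𝓝 0)) ∧
            ∀ x : E4, poincareInv (mo i).1 (mo i).2 x 0 = 0 →
              Kerr.rPlus (M i) (a i) ≤ Kerr.radius (a i) (poincareInv (mo i).1 (mo i).2 x) →
              ∀ m, m ≤ k → iteratedFDeriv ℝ m g x = 0 := by
  intro X _ _ _ _ D k 𝒟 hrec
  obtain ⟨_, N, M, a, mo, τ₀, Ψ, _, _, _, _, hsub, hcharts, -, -, -, -, -, -, -, -, T, hT, -,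
    hrecT⟩ := (recurs_iff_exists_seq k 𝒟).1 hrec
  refine ⟨N, M, a, mo, τ₀, Ψ, T, hsub, fun i ↦ (hcharts i).contMDiff, hT, hrecT,
    fun i Ψs hΨs hext hfin ↦ ?_⟩
  -- along `T` the restriction `Ψs ∘ ι = Ψ i` recurs at every radius
  have hrec' : ∀ R' : ℝ, Tendsto (fun n ↦ 𝒟.toSpacetime.truncDeviationCk
      (boostedKerrBackground (mo i).1 (mo i).2 (M i) (a i))
      (Ψs ∘ Opens.inclusion (boostedKerrExterior_le_starBackground_domain (mo i).1 (mo i).2 (M i)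
        (a i) fun x ↦ Kerr.radius (a i) (poincareInv (mo i).1 (mo i).2 x))) k R' (T n))
      atTop (𝓝 0) := fun R' ↦ hext ▸ hrecT i R'
  exact starHole_omegaLimit_flat_of_recurrence 𝒟.toSpacetime (mo i).1 (mo i).2 (hsub i) hΨs hfin
    hT hrec'

/-- **`Recurs k 𝒟` feeds the star dictionary, jointly: one common subsequence for all holes.** If
the maximal development `𝒟` recurs at order `k`, then its hole data `(Mᵢ, aᵢ)`, `moᵢ = (Λᵢ, cᵢ)`,
`τ₀`, `Ψᵢ` and one recurrence sequence `T n → ∞` (as in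
`exists_holes_of_recurs_forall_starExtension_omegaLimit_flat`) are such that WHENEVER ALL hole
charts extend to smooth charts `Ψsᵢ` on the star backgrounds
`starBackground Λᵢ cᵢ Mᵢ aᵢ (x ↦ r_{aᵢ}(Λᵢ⁻¹(x − cᵢ)))` (`Ψ i = Ψs i ∘ ι`) which are tame after `τ₀`
(finite `C^{k+1}` sup norms of the star deviations `dev★ᵢ` over the star truncated late regions),
ONE strictly increasing `φ` gives EVERY hole a `Cᵏ` field `gᵢ` on its star domain to which the
translates `dev★ᵢ (· + T (φ n) • Λᵢ∂₀)` converge in `Cᵏ` on every compact subset of the star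
domain, flat to order `k` on the closed time-zero slab `{t*ᵢ = 0, r ≥ r₊}`. Proof: the joint
extraction `exists_strictMono_forall_omegaLimit_translate` (`…JointOmegaLimits`) for the systems
`(star backgroundᵢ, Λᵢ∂₀, dev★ᵢ)` — star domains `Λᵢ∂₀`-invariant
(`add_smul_mem_starBackground_domain`), `t*ᵢ` shifted and `rᵢ` preserved
(`KerrSchildChart.time_add_smul / radius_add_smul`), `dev★ᵢ` smooth
(`contDiffOn_deviationExtend_star`), tameness giving pointwise bounds
(`norm_iteratedFDeriv_le_toReal_supCkENorm`) — then, hole by hole along `T ∘ φ`, the forward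
direction of `tendsto_truncDeviationCk_restrict_star_iff_iteratedFDeriv_omegaLimit_eq_zero` and
`iteratedFDeriv_eq_zero_closedSlab_of_eq_zero_timeSlab`. The joint ω-limits are what the
identification step of a line consumes (`liminf maxᵢ ≠ maxᵢ liminf`; Hale 1980, Ch. I, §8).
[cite: Hale1980, Ch. I §8] -/
theorem exists_holes_of_recurs_strictMono_forall_starExtension_omegaLimit_flat :
    ∀ {X : Type} [TopologicalSpace X] [ChartedSpace E3 X] [IsManifold (𝓡 3) ∞ X]
      [ConnectedSpace X] {D : InitialDataSet (𝓡 3) X} (k : ℕ) (𝒟 : VacuumCauchyDevelopment D),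
      Recurs k 𝒟 →
      ∃ (N : ℕ) (M a : Fin N → ℝ) (mo : Fin N → lorentzGroup × E4) (τ₀ : ℝ)
        (Ψ : ∀ i, (boostedKerrBackground (mo i).1 (mo i).2 (M i) (a i)).domain → 𝒟.carrier)
        (T : ℕ → ℝ),
        (∀ i, Kerr.IsSubextremal (M i) (a i)) ∧ (∀ i, ContMDiff 𝓘(ℝ, E4) (𝓡 4) ∞ (Ψ i)) ∧
        Tendsto T atTop atTop ∧
        (∀ i (R' : ℝ), Tendsto (fun n ↦ 𝒟.toSpacetime.truncDeviationCk
          (boostedKerrBackground (mo i).1 (mo i).2 (M i) (a i)) (Ψ i) k R' (T n)) atTop (𝓝 0)) ∧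
        ∀ Ψs : ∀ i, (starBackground (mo i).1 (mo i).2 (M i) (a i)
            fun x ↦ Kerr.radius (a i) (poincareInv (mo i).1 (mo i).2 x)).domain → 𝒟.carrier,
          (∀ i, ContMDiff 𝓘(ℝ, E4) (𝓡 4) ∞ (Ψs i)) →
          (∀ i, Ψ i = Ψs i ∘ Opens.inclusion (boostedKerrExterior_le_starBackground_domain
            (mo i).1 (mo i).2 (M i) (a i)
              fun x ↦ Kerr.radius (a i) (poincareInv (mo i).1 (mo i).2 x))) →
          (∀ i (R : ℝ), supCkENorm (Subtype.val '' (starBackground (mo i).1 (mo i).2 (M i) (a i)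
              fun x ↦ Kerr.radius (a i) (poincareInv (mo i).1 (mo i).2 x)).truncLateRegion τ₀ R)
            (k + 1) (𝒟.toSpacetime.deviationExtend (starBackground (mo i).1 (mo i).2 (M i) (a i)
              fun x ↦ Kerr.radius (a i) (poincareInv (mo i).1 (mo i).2 x)) (Ψs i)) ≠ ⊤) →
          ∃ φ : ℕ → ℕ, StrictMono φ ∧ ∀ i, ∃ g : E4 → E4 →L[ℝ] E4 →L[ℝ] ℝ,
            ContDiffOn ℝ k g ((starBackground (mo i).1 (mo i).2 (M i) (a i)
              fun x ↦ Kerr.radius (a i) (poincareInv (mo i).1 (mo i).2 x)).domain : Set E4) ∧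
            (∀ K ⊆ ((starBackground (mo i).1 (mo i).2 (M i) (a i)
                fun x ↦ Kerr.radius (a i) (poincareInv (mo i).1 (mo i).2 x)).domain : Set E4),
              IsCompact K →
              Tendsto (fun n ↦ supCkENorm K k (fun x ↦
                𝒟.toSpacetime.deviationExtend (starBackground (mo i).1 (mo i).2 (M i) (a i)
                  fun x ↦ Kerr.radius (a i) (poincareInv (mo i).1 (mo i).2 x)) (Ψs i)
                  (x + T (φ n) • ((mo i).1 : E4 ≃L[ℝ] E4)
                    (EuclideanSpace.single (0 : Fin 4) (1 : ℝ))) - g x)) atTop (𝓝 0)) ∧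
            ∀ x : E4, poincareInv (mo i).1 (mo i).2 x 0 = 0 →
              Kerr.rPlus (M i) (a i) ≤ Kerr.radius (a i) (poincareInv (mo i).1 (mo i).2 x) →
              ∀ m, m ≤ k → iteratedFDeriv ℝ m g x = 0 := by
  intro X _ _ _ _ D k 𝒟 hrec
  obtain ⟨_, N, M, a, mo, τ₀, Ψ, _, _, _, _, hsub, hcharts, -, -, -, -, -, -, -, -, T, hT, -,
    hrecT⟩ := (recurs_iff_exists_seq k 𝒟).1 hrec
  refine ⟨N, M, a, mo, τ₀, Ψ, T, hsub, fun i ↦ (hcharts i).contMDiff, hT, hrecT,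
    fun Ψs hΨs hext hfin ↦ ?_⟩
  -- joint `Cᵏ_loc` ω-limits of the star deviations along ONE subsequence of `T`
  obtain ⟨φ, hφ, hlim⟩ := exists_strictMono_forall_omegaLimit_translate N
    (fun i ↦ starBackground (mo i).1 (mo i).2 (M i) (a i)
      fun x ↦ Kerr.radius (a i) (poincareInv (mo i).1 (mo i).2 x))
    (fun i ↦ ((mo i).1 : E4 ≃L[ℝ] E4) (EuclideanSpace.single (0 : Fin 4) (1 : ℝ)))
    (fun i ↦ add_smul_mem_starBackground_domain (mo i).1 (mo i).2 (M i) (a i) _)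
    (fun i ↦ KerrSchildChart.time_add_smul (mo i).1 (mo i).2 (M i) (a i))
    (fun i ↦ KerrSchildChart.radius_add_smul (mo i).1 (mo i).2 (M i) (a i))
    (fun i ↦ (PiLp.continuous_apply 2 _ 0).comp (continuous_poincareInv (mo i).1 (mo i).2))
    (fun i ↦ (Kerr.continuous_radius (a i)).comp (continuous_poincareInv (mo i).1 (mo i).2))
    (k := k) (h := fun i ↦ 𝒟.toSpacetime.deviationExtend (starBackground (mo i).1 (mo i).2 (M i)
      (a i) fun x ↦ Kerr.radius (a i) (poincareInv (mo i).1 (mo i).2 x)) (Ψs i))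
    (fun i ↦ (contDiffOn_deviationExtend_star 𝒟.toSpacetime (hΨs i)).of_le
      (by exact_mod_cast le_top))
    (τ₀ := τ₀) (fun i R ↦ ⟨_, fun _ hj _ hx ↦
      norm_iteratedFDeriv_le_toReal_supCkENorm hj hx _ (hfin i R)⟩) hT
  refine ⟨φ, hφ, fun i ↦ ?_⟩
  obtain ⟨g, hg, hlimi⟩ := hlim i
  -- along `T ∘ φ` the restriction `Ψs i ∘ ι = Ψ i` still recurs at every radius
  have hrec' : ∀ R' : ℝ, Tendsto (fun n ↦ 𝒟.toSpacetime.truncDeviationCk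
      (boostedKerrBackground (mo i).1 (mo i).2 (M i) (a i))
      (Ψs i ∘ Opens.inclusion (boostedKerrExterior_le_starBackground_domain (mo i).1 (mo i).2
        (M i) (a i) fun x ↦ Kerr.radius (a i) (poincareInv (mo i).1 (mo i).2 x))) k R'
      (T (φ n))) atTop (𝓝 0) := fun R' ↦ hext i ▸ (hrecT i R').comp hφ.tendsto_atTop
  -- so `g` is flat on the open exterior slab, hence on the closed slab
  have hflat : ∀ x ∈ Subtype.val ''
      (boostedKerrBackground (mo i).1 (mo i).2 (M i) (a i)).timeSlab 0,
      ∀ m, m ≤ k → iteratedFDeriv ℝ m g x = 0 :=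
    (tendsto_truncDeviationCk_restrict_star_iff_iteratedFDeriv_omegaLimit_eq_zero 𝒟.toSpacetime
      (mo i).1 (mo i).2 (hsub i) _ (hΨs i) hg hlimi).1 hrec'
  exact ⟨g, hg, hlimi,
    iteratedFDeriv_eq_zero_closedSlab_of_eq_zero_timeSlab (mo i).1 (mo i).2 (hsub i) _ hg hflat⟩

end Summit.FinalStateConjecture.FinalStateConjecture.Theorems.ClusterCompleteness

end
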